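import Summits.QuantumFields.YangMills.Theorems.TransportPerturbationDoeblinSelector
import HarnessLib

/-!
# Route `TransportPerturbation`, LINE 10 «harris_hybrid» (crux K1 `LyapunovContraction`, stmt-QuantumFields-26986; organ
# `RegularPairOverlap` 27873, rung `FixedCutoffOverlap`): a MEASURABLE DOEBLIN COUPLING IN MAP FORM from a common
# minorisation, with prescribed marginals and meeting probability `≥ c²`

Helper file (seat `ym-line-csu-p1`, g11, free hands; CSU lead memo g10 §3(b)(ii)), part 2 of 2 (part 1:
`…DoeblinSelector`).  The line's object (`IsCoupling` of the skeleton `harris_hybrid_v3`) is a pair of maps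
`T₃ T₄ : X → X → Ω₂ → X` on ONE auxiliary probability space, jointly measurable in `(x, y, ω)`, whose laws from `(x, y)` are
the transition laws from `x` and from `y`; the rung / organ ask that the truncated currency of `(T₃, T₄)` has mean `≤ 1 − η`.
This file builds such maps from a COMMON COMPONENT:

Data: a probability space `(Ω, P)`, a jointly measurable random map `V : X → Ω → X` (the solution family at the window
time), a reference probability `π` on `X`, a jointly measurable density `p : X → X → ℝ≥0∞` with `law(V x) = p(x,·) · π`,
and a constant `c` with `c ≤ p(x,·)` `π`-a.e. for every `x` (Doeblin minorisation `c·π ≤ law(V x)`).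
Construction (no residual-kernel sampling): `Ω₂ := (Ω × Ω) × (X × ℝ)`, `P₂ := (P ⊗ P) ⊗ (π ⊗ Leb|[0,1])`, and with
`ω = ((ω₁, ω₂), (z, ξ))`

  `T₃ x y ω := if ξ · p(x, V x ω₁) ≤ c then z else V x ω₁`,  `T₄ x y ω := if ξ · p(y, V y ω₂) ≤ c then z else V y ω₂`.

* `measurable_select₃/₄` — joint measurability in `((x, y), ω)`;
* ★ `map_select₃_eq`, `map_select₄_eq` — the marginals: `law(T₃ x y) = law(V x)`, `law(T₄ x y) = law(V y)` (part 1's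
  `map_select_eq` on `Ω' = Ω × Ω`);
* ★ `measure_compl_acc_le` — both copies accept the SAME fresh sample `z` with probability `≥ c²` (independence of
  `ω₁, ω₂` and `m(a) m(b) ≤ Leb(acc a ∩ acc b)`), and then `T₃ = T₄` (`select_eq_of_acc`);
* `integral_comp_select₃/₄`, `integral_trunc_le` — the same in the `∫ f ∘ T` / truncated-currency form of `IsCoupling`:
  for every jointly measurable `0 ≤ d ≤ 1` with `d z z = 0`, `∫ d(T₃ x y, T₄ x y) dP₂ ≤ 1 − c²`.

Generic in `X`, `Ω`; the SZZ instantiation (minorisation from `doeblin_szz`, density from `Kernel.rnDeriv`) is a separate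
file.  THEOREMS ONLY, [folklore] (Doeblin 1938 / Nummelin splitting; e.g. Roberts–Rosenthal, Probab. Surveys 1 (2004)
§4.2, in map form); no crux, rung or summit is proved here; the Yang–Mills mass gap is NOT proved.
-/

set_option autoImplicit false

noncomputable section

namespace Summit.QuantumFields.YangMills.Theorems.TransportPerturbation.DoeblinCoupling

open MeasureTheory Set
open scoped ENNReal

/-! ## The coupling -/

section Coupling

variable {X : Type*} [MeasurableSpace X] {Ω : Type*} [MeasurableSpace Ω]

/-- `T₃` is jointly measurable in `((x, y), ω)`. [folklore] -/
theorem measurable_select₃ {V : X → Ω → X} (hV : Measurable fun q : X × Ω => V q.1 q.2)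
    {p : X → X → ℝ≥0∞} (hp : Measurable fun q : X × X => p q.1 q.2) (c : ℝ≥0∞) :
    Measurable fun r : (X × X) × ((Ω × Ω) × (X × ℝ)) =>
      if ENNReal.ofReal r.2.2.2 * p r.1.1 (V r.1.1 r.2.1.1) ≤ c then r.2.2.1 else V r.1.1 r.2.1.1 := by
  have hW : Measurable fun r : (X × X) × ((Ω × Ω) × (X × ℝ)) => V r.1.1 r.2.1.1 :=
    hV.comp (measurable_fst.fst.prodMk measurable_snd.fst.fst)
  refine Measurable.ite ?_ measurable_snd.snd.fst hW
  exact measurableSet_le ((ENNReal.measurable_ofReal.comp measurable_snd.snd.snd).mul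
    (hp.comp (measurable_fst.fst.prodMk hW))) measurable_const

/-- `T₄` is jointly measurable in `((x, y), ω)`. [folklore] -/
theorem measurable_select₄ {V : X → Ω → X} (hV : Measurable fun q : X × Ω => V q.1 q.2)
    {p : X → X → ℝ≥0∞} (hp : Measurable fun q : X × X => p q.1 q.2) (c : ℝ≥0∞) :
    Measurable fun r : (X × X) × ((Ω × Ω) × (X × ℝ)) =>
      if ENNReal.ofReal r.2.2.2 * p r.1.2 (V r.1.2 r.2.1.2) ≤ c then r.2.2.1 else V r.1.2 r.2.1.2 := by
  have hW : Measurable fun r : (X × X) × ((Ω × Ω) × (X × ℝ)) => V r.1.2 r.2.1.2 :=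
    hV.comp (measurable_fst.snd.prodMk measurable_snd.fst.snd)
  refine Measurable.ite ?_ measurable_snd.snd.fst hW
  exact measurableSet_le ((ENNReal.measurable_ofReal.comp measurable_snd.snd.snd).mul
    (hp.comp (measurable_fst.snd.prodMk hW))) measurable_const

variable (P : Measure Ω) [IsProbabilityMeasure P] (π : Measure X) [IsProbabilityMeasure π]

/-- The auxiliary space `(Ω × Ω) × (X × [0,1])` carries a probability measure. [folklore] -/
theorem isProbabilityMeasure_aux :
    IsProbabilityMeasure ((P.prod P).prod (π.prod (volume.restrict (Icc (0 : ℝ) 1)))) := by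
  haveI : IsProbabilityMeasure (volume.restrict (Icc (0 : ℝ) 1)) := ⟨by simp⟩
  infer_instance

variable {V : X → Ω → X} {p : X → X → ℝ≥0∞} {c : ℝ≥0∞}

/-- ★ **Marginal of `T₃`**: `law(T₃ x y) = law(V x)`. [folklore] -/
theorem map_select₃_eq (hV : Measurable fun q : X × Ω => V q.1 q.2) (hp : Measurable fun q : X × X => p q.1 q.2)
    (hc : c ≠ ⊤) (hlaw : ∀ x, P.map (V x) = π.withDensity (p x)) (hmin : ∀ x, ∀ᵐ w ∂π, c ≤ p x w) (x : X) :
    ((P.prod P).prod (π.prod (volume.restrict (Icc (0 : ℝ) 1)))).map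
        (fun ω : (Ω × Ω) × (X × ℝ) => if ENNReal.ofReal ω.2.2 * p x (V x ω.1.1) ≤ c then ω.2.1 else V x ω.1.1) =
      P.map (V x) := by
  have hVx : Measurable (V x) := hV.comp (measurable_const.prodMk measurable_id)
  have hS : Measurable fun ω' : Ω × Ω => V x ω'.1 := hVx.comp measurable_fst
  have hlaw' : (P.prod P).map (fun ω' : Ω × Ω => V x ω'.1) = π.withDensity (p x) := by
    rw [← hlaw x, show (fun ω' : Ω × Ω => V x ω'.1) = V x ∘ Prod.fst from rfl, ← Measure.map_map hVx measurable_fst,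
      Measure.map_fst_prod, measure_univ, one_smul]
  rw [hlaw x]
  exact map_select_eq (P.prod P) π hS (hp.comp (measurable_const.prodMk measurable_id)) hc hlaw' (hmin x)

/-- ★ **Marginal of `T₄`**: `law(T₄ x y) = law(V y)`. [folklore] -/
theorem map_select₄_eq (hV : Measurable fun q : X × Ω => V q.1 q.2) (hp : Measurable fun q : X × X => p q.1 q.2)
    (hc : c ≠ ⊤) (hlaw : ∀ x, P.map (V x) = π.withDensity (p x)) (hmin : ∀ x, ∀ᵐ w ∂π, c ≤ p x w) (y : X) :
    ((P.prod P).prod (π.prod (volume.restrict (Icc (0 : ℝ) 1)))).map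
        (fun ω : (Ω × Ω) × (X × ℝ) => if ENNReal.ofReal ω.2.2 * p y (V y ω.1.2) ≤ c then ω.2.1 else V y ω.1.2) =
      P.map (V y) := by
  have hVy : Measurable (V y) := hV.comp (measurable_const.prodMk measurable_id)
  have hS : Measurable fun ω' : Ω × Ω => V y ω'.2 := hVy.comp measurable_snd
  have hlaw' : (P.prod P).map (fun ω' : Ω × Ω => V y ω'.2) = π.withDensity (p y) := by
    rw [← hlaw y, show (fun ω' : Ω × Ω => V y ω'.2) = V y ∘ Prod.snd from rfl, ← Measure.map_map hVy measurable_snd,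
      Measure.map_snd_prod, measure_univ, one_smul]
  rw [hlaw y]
  exact map_select_eq (P.prod P) π hS (hp.comp (measurable_const.prodMk measurable_id)) hc hlaw' (hmin y)

/-- ★ **Joint acceptance has probability `≥ c²`**: the complement of the event «both copies accept the common fresh
sample» has `P₂`-measure `≤ 1 − c²` (independence of `ω₁, ω₂`; `m(a) m(b) ≤ Leb(acc a ∩ acc b)`). [folklore] -/
theorem measure_compl_acc_le (hV : Measurable fun q : X × Ω => V q.1 q.2) (hp : Measurable fun q : X × X => p q.1 q.2)
    (hc : c ≠ ⊤) (hlaw : ∀ x, P.map (V x) = π.withDensity (p x)) (hmin : ∀ x, ∀ᵐ w ∂π, c ≤ p x w) (x y : X) :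
    ((P.prod P).prod (π.prod (volume.restrict (Icc (0 : ℝ) 1))))
        {ω : (Ω × Ω) × (X × ℝ) | ENNReal.ofReal ω.2.2 * p x (V x ω.1.1) ≤ c ∧
          ENNReal.ofReal ω.2.2 * p y (V y ω.1.2) ≤ c}ᶜ ≤ 1 - c * c := by
  haveI : IsProbabilityMeasure (volume.restrict (Icc (0 : ℝ) 1)) := ⟨by simp⟩
  haveI := isProbabilityMeasure_aux P π
  have hVx : Measurable (V x) := hV.comp (measurable_const.prodMk measurable_id)
  have hVy : Measurable (V y) := hV.comp (measurable_const.prodMk measurable_id)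
  have hpx : Measurable (p x) := hp.comp (measurable_const.prodMk measurable_id)
  have hpy : Measurable (p y) := hp.comp (measurable_const.prodMk measurable_id)
  -- the joint acceptance event
  set E : Set ((Ω × Ω) × (X × ℝ)) := {ω | ENNReal.ofReal ω.2.2 * p x (V x ω.1.1) ≤ c ∧
    ENNReal.ofReal ω.2.2 * p y (V y ω.1.2) ≤ c} with hE
  have ha₁ : Measurable fun ω : (Ω × Ω) × (X × ℝ) => ENNReal.ofReal ω.2.2 * p x (V x ω.1.1) :=
    (ENNReal.measurable_ofReal.comp measurable_snd.snd).mul (hpx.comp (hVx.comp measurable_fst.fst))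
  have ha₂ : Measurable fun ω : (Ω × Ω) × (X × ℝ) => ENNReal.ofReal ω.2.2 * p y (V y ω.1.2) :=
    (ENNReal.measurable_ofReal.comp measurable_snd.snd).mul (hpy.comp (hVy.comp measurable_fst.snd))
  have hEm : MeasurableSet E := (measurableSet_le ha₁ measurable_const).inter (measurableSet_le ha₂ measurable_const)
  rw [prob_compl_eq_one_sub hEm]
  refine tsub_le_tsub_left ?_ 1
  -- `c · c ≤ P₂(E)`: sections and independence
  rw [Measure.prod_apply hEm]
  have hsec : ∀ ω' : Ω × Ω, (π.prod (volume.restrict (Icc (0 : ℝ) 1))) (Prod.mk ω' ⁻¹' E) =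
      (volume.restrict (Icc (0 : ℝ) 1)) ({ξ : ℝ | ENNReal.ofReal ξ * p x (V x ω'.1) ≤ c} ∩
        {ξ : ℝ | ENNReal.ofReal ξ * p y (V y ω'.2) ≤ c}) := by
    intro ω'
    have : Prod.mk ω' ⁻¹' E = (univ : Set X) ×ˢ ({ξ : ℝ | ENNReal.ofReal ξ * p x (V x ω'.1) ≤ c} ∩
        {ξ : ℝ | ENNReal.ofReal ξ * p y (V y ω'.2) ≤ c}) := by
      ext ⟨z, ξ⟩
      simp [hE]
    rw [this, Measure.prod_prod, measure_univ, one_mul]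
  simp_rw [hsec]
  have hf : Measurable fun ω₁ : Ω => (volume.restrict (Icc (0 : ℝ) 1)) {ξ : ℝ | ENNReal.ofReal ξ * p x (V x ω₁) ≤ c} :=
    (measurable_volume_acc c).comp (hpx.comp hVx)
  have hg : Measurable fun ω₂ : Ω => (volume.restrict (Icc (0 : ℝ) 1)) {ξ : ℝ | ENNReal.ofReal ξ * p y (V y ω₂) ≤ c} :=
    (measurable_volume_acc c).comp (hpy.comp hVy)
  have hprod : (∫⁻ ω' : Ω × Ω, (volume.restrict (Icc (0 : ℝ) 1)) {ξ : ℝ | ENNReal.ofReal ξ * p x (V x ω'.1) ≤ c} *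
      (volume.restrict (Icc (0 : ℝ) 1)) {ξ : ℝ | ENNReal.ofReal ξ * p y (V y ω'.2) ≤ c} ∂(P.prod P)) =
      (∫⁻ ω₁, (volume.restrict (Icc (0 : ℝ) 1)) {ξ : ℝ | ENNReal.ofReal ξ * p x (V x ω₁) ≤ c} ∂P) *
        ∫⁻ ω₂, (volume.restrict (Icc (0 : ℝ) 1)) {ξ : ℝ | ENNReal.ofReal ξ * p y (V y ω₂) ≤ c} ∂P :=
    lintegral_prod_mul (f := fun ω₁ : Ω => (volume.restrict (Icc (0 : ℝ) 1)) {ξ : ℝ | ENNReal.ofReal ξ * p x (V x ω₁) ≤ c})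
      (g := fun ω₂ : Ω => (volume.restrict (Icc (0 : ℝ) 1)) {ξ : ℝ | ENNReal.ofReal ξ * p y (V y ω₂) ≤ c})
      hf.aemeasurable hg.aemeasurable
  calc c * c = (∫⁻ ω₁, (volume.restrict (Icc (0 : ℝ) 1)) {ξ : ℝ | ENNReal.ofReal ξ * p x (V x ω₁) ≤ c} ∂P) *
        ∫⁻ ω₂, (volume.restrict (Icc (0 : ℝ) 1)) {ξ : ℝ | ENNReal.ofReal ξ * p y (V y ω₂) ≤ c} ∂P := by
          rw [lintegral_volume_acc_eq P π hVx hpx hc (hlaw x) (hmin x), lintegral_volume_acc_eq P π hVy hpy hc (hlaw y) (hmin y)]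
    _ = ∫⁻ ω' : Ω × Ω, (volume.restrict (Icc (0 : ℝ) 1)) {ξ : ℝ | ENNReal.ofReal ξ * p x (V x ω'.1) ≤ c} *
          (volume.restrict (Icc (0 : ℝ) 1)) {ξ : ℝ | ENNReal.ofReal ξ * p y (V y ω'.2) ≤ c} ∂(P.prod P) := hprod.symm
    _ ≤ _ := lintegral_mono fun ω' => mul_volume_acc_le_inter _ _ c

omit [MeasurableSpace X] [MeasurableSpace Ω] [IsProbabilityMeasure P] [IsProbabilityMeasure π] in
/-- On the joint acceptance event both selectors return the common fresh sample. [folklore] -/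
theorem select_eq_of_acc (x y : X) (ω : (Ω × Ω) × (X × ℝ))
    (h : ENNReal.ofReal ω.2.2 * p x (V x ω.1.1) ≤ c ∧ ENNReal.ofReal ω.2.2 * p y (V y ω.1.2) ≤ c) :
    (if ENNReal.ofReal ω.2.2 * p x (V x ω.1.1) ≤ c then ω.2.1 else V x ω.1.1) =
      (if ENNReal.ofReal ω.2.2 * p y (V y ω.1.2) ≤ c then ω.2.1 else V y ω.1.2) := by
  rw [if_pos h.1, if_pos h.2]

/-! ### Real-valued forms (the `IsCoupling` shape of the TP skeleton) -/

/-- Measurability of `T₃ x y` as a map of `ω` alone. [folklore] -/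
theorem measurable_select₃_at (hV : Measurable fun q : X × Ω => V q.1 q.2) (hp : Measurable fun q : X × X => p q.1 q.2)
    (x y : X) :
    Measurable fun ω : (Ω × Ω) × (X × ℝ) => if ENNReal.ofReal ω.2.2 * p x (V x ω.1.1) ≤ c then ω.2.1 else V x ω.1.1 :=
  (measurable_select₃ hV hp c).comp ((measurable_const (a := (x, y))).prodMk measurable_id)

/-- Measurability of `T₄ x y` as a map of `ω` alone. [folklore] -/
theorem measurable_select₄_at (hV : Measurable fun q : X × Ω => V q.1 q.2) (hp : Measurable fun q : X × X => p q.1 q.2)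
    (x y : X) :
    Measurable fun ω : (Ω × Ω) × (X × ℝ) => if ENNReal.ofReal ω.2.2 * p y (V y ω.1.2) ≤ c then ω.2.1 else V y ω.1.2 :=
  (measurable_select₄ hV hp c).comp ((measurable_const (a := (x, y))).prodMk measurable_id)

/-- Marginal of `T₃` in integral form: `∫ f(T₃ x y) dP₂ = ∫ f(V x) dP` for measurable `f`. [folklore] -/
theorem integral_comp_select₃ (hV : Measurable fun q : X × Ω => V q.1 q.2) (hp : Measurable fun q : X × X => p q.1 q.2)
    (hc : c ≠ ⊤) (hlaw : ∀ x, P.map (V x) = π.withDensity (p x)) (hmin : ∀ x, ∀ᵐ w ∂π, c ≤ p x w)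
    {f : X → ℝ} (hf : Measurable f) (x y : X) :
    (∫ ω, f (if ENNReal.ofReal ω.2.2 * p x (V x ω.1.1) ≤ c then ω.2.1 else V x ω.1.1)
        ∂((P.prod P).prod (π.prod (volume.restrict (Icc (0 : ℝ) 1))))) = ∫ ω, f (V x ω) ∂P := by
  have hT := measurable_select₃_at (c := c) hV hp x y
  have hVx : Measurable (V x) := hV.comp (measurable_const.prodMk measurable_id)
  rw [← integral_map hT.aemeasurable hf.aestronglyMeasurable, map_select₃_eq P π hV hp hc hlaw hmin x,
    integral_map hVx.aemeasurable hf.aestronglyMeasurable]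

/-- Marginal of `T₄` in integral form: `∫ f(T₄ x y) dP₂ = ∫ f(V y) dP` for measurable `f`. [folklore] -/
theorem integral_comp_select₄ (hV : Measurable fun q : X × Ω => V q.1 q.2) (hp : Measurable fun q : X × X => p q.1 q.2)
    (hc : c ≠ ⊤) (hlaw : ∀ x, P.map (V x) = π.withDensity (p x)) (hmin : ∀ x, ∀ᵐ w ∂π, c ≤ p x w)
    {f : X → ℝ} (hf : Measurable f) (x y : X) :
    (∫ ω, f (if ENNReal.ofReal ω.2.2 * p y (V y ω.1.2) ≤ c then ω.2.1 else V y ω.1.2)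
        ∂((P.prod P).prod (π.prod (volume.restrict (Icc (0 : ℝ) 1))))) = ∫ ω, f (V y ω) ∂P := by
  have hT := measurable_select₄_at (c := c) hV hp x y
  have hVy : Measurable (V y) := hV.comp (measurable_const.prodMk measurable_id)
  rw [← integral_map hT.aemeasurable hf.aestronglyMeasurable, map_select₄_eq P π hV hp hc hlaw hmin y,
    integral_map hVy.aemeasurable hf.aestronglyMeasurable]

/-- ★ **Truncated-currency bound**: for any jointly measurable `d : X → X → ℝ` with `0 ≤ d ≤ 1` and `d z z = 0`,
`∫ d(T₃ x y, T₄ x y) dP₂ ≤ 1 − c²` (`c ≤ 1`, read as a real number). [folklore] -/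
theorem integral_trunc_le (hV : Measurable fun q : X × Ω => V q.1 q.2) (hp : Measurable fun q : X × X => p q.1 q.2)
    (hc1 : c ≤ 1) (hlaw : ∀ x, P.map (V x) = π.withDensity (p x)) (hmin : ∀ x, ∀ᵐ w ∂π, c ≤ p x w)
    {d : X → X → ℝ} (hd : Measurable fun q : X × X => d q.1 q.2) (hd0 : ∀ u v, 0 ≤ d u v) (hd1 : ∀ u v, d u v ≤ 1)
    (hdd : ∀ z, d z z = 0) (x y : X) :
    (∫ ω, d (if ENNReal.ofReal ω.2.2 * p x (V x ω.1.1) ≤ c then ω.2.1 else V x ω.1.1)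
        (if ENNReal.ofReal ω.2.2 * p y (V y ω.1.2) ≤ c then ω.2.1 else V y ω.1.2)
        ∂((P.prod P).prod (π.prod (volume.restrict (Icc (0 : ℝ) 1))))) ≤ 1 - c.toReal ^ 2 := by
  haveI := isProbabilityMeasure_aux P π
  have hc : c ≠ ⊤ := ne_top_of_le_ne_top ENNReal.one_ne_top hc1
  set P₂ := (P.prod P).prod (π.prod (volume.restrict (Icc (0 : ℝ) 1))) with hP₂
  have hT₃m := measurable_select₃_at (c := c) hV hp x y
  have hT₄m := measurable_select₄_at (c := c) hV hp x y
  have hVx : Measurable (V x) := hV.comp (measurable_const.prodMk measurable_id)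
  have hVy : Measurable (V y) := hV.comp (measurable_const.prodMk measurable_id)
  have hpx : Measurable (p x) := hp.comp (measurable_const.prodMk measurable_id)
  have hpy : Measurable (p y) := hp.comp (measurable_const.prodMk measurable_id)
  -- the joint acceptance event and its complement
  set E : Set ((Ω × Ω) × (X × ℝ)) := {ω | ENNReal.ofReal ω.2.2 * p x (V x ω.1.1) ≤ c ∧
    ENNReal.ofReal ω.2.2 * p y (V y ω.1.2) ≤ c} with hE
  have ha₁ : Measurable fun ω : (Ω × Ω) × (X × ℝ) => ENNReal.ofReal ω.2.2 * p x (V x ω.1.1) :=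
    (ENNReal.measurable_ofReal.comp measurable_snd.snd).mul (hpx.comp (hVx.comp measurable_fst.fst))
  have ha₂ : Measurable fun ω : (Ω × Ω) × (X × ℝ) => ENNReal.ofReal ω.2.2 * p y (V y ω.1.2) :=
    (ENNReal.measurable_ofReal.comp measurable_snd.snd).mul (hpy.comp (hVy.comp measurable_fst.snd))
  have hEm : MeasurableSet E := (measurableSet_le ha₁ measurable_const).inter (measurableSet_le ha₂ measurable_const)
  -- `d(T₃, T₄) ≤ 𝟙_{Eᶜ}` pointwise
  have hle : ∀ ω : (Ω × Ω) × (X × ℝ),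
      d (if ENNReal.ofReal ω.2.2 * p x (V x ω.1.1) ≤ c then ω.2.1 else V x ω.1.1)
        (if ENNReal.ofReal ω.2.2 * p y (V y ω.1.2) ≤ c then ω.2.1 else V y ω.1.2) ≤
      Eᶜ.indicator (fun _ => (1 : ℝ)) ω := by
    intro ω
    by_cases h : ω ∈ E
    · have hω : ω ∉ Eᶜ := fun h' => h' h
      rw [indicator_of_notMem hω, select_eq_of_acc x y ω h, hdd]
    · rw [indicator_of_mem (mem_compl h)]
      exact hd1 _ _
  have hint : Integrable (fun ω : (Ω × Ω) × (X × ℝ) =>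
      d (if ENNReal.ofReal ω.2.2 * p x (V x ω.1.1) ≤ c then ω.2.1 else V x ω.1.1)
        (if ENNReal.ofReal ω.2.2 * p y (V y ω.1.2) ≤ c then ω.2.1 else V y ω.1.2)) P₂ := by
    refine Integrable.of_bound (C := 1) ((hd.comp (hT₃m.prodMk hT₄m)).aestronglyMeasurable) ?_
    exact Filter.Eventually.of_forall fun ω => by
      rw [Real.norm_eq_abs, abs_of_nonneg (hd0 _ _)]; exact hd1 _ _
  calc _ ≤ ∫ ω, Eᶜ.indicator (fun _ => (1 : ℝ)) ω ∂P₂ := integral_mono hint ((integrable_const 1).indicator hEm.compl) hle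
    _ = P₂.real Eᶜ := by
        rw [integral_indicator hEm.compl, integral_const, smul_eq_mul, mul_one, measureReal_restrict_apply_univ]
    _ ≤ (1 - c * c).toReal := by
        rw [measureReal_def]
        exact ENNReal.toReal_mono (ne_top_of_le_ne_top ENNReal.one_ne_top tsub_le_self)
          (measure_compl_acc_le P π hV hp hc hlaw hmin x y)
    _ = 1 - c.toReal ^ 2 := by
        rw [ENNReal.toReal_sub_of_le (by simpa using mul_le_mul' hc1 hc1) ENNReal.one_ne_top, ENNReal.toReal_one,
          ENNReal.toReal_mul, sq]

end Coupling

end Summit.QuantumFields.YangMills.Theorems.TransportPerturbation.DoeblinCoupling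

end
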